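import Mathlib
import Summits.ValiantsHypothesis.ValiantsHypothesis.Theses.RefutationDegree
import Literature.Computability.AlgebraicComplexity.StandardFamilies
import Literature.Computability.AlgebraicComplexity.HessianAtOrigin
import Literature.Computability.AlgebraicComplexity.LandsbergRessayreNormalForm
import Literature.Computability.AlgebraicComplexity.MignonRessayreBound
import Literature.Computability.AlgebraicComplexity.OrbitClosureEuclidean
import Summits.ValiantsHypothesis.ValiantsHypothesis.Theorems.RefutationDegreeBeyondHessianNsJetCalibrationTranslated
import Summits.ValiantsHypothesis.ValiantsHypothesis.Theorems.RefutationDegreeBeyondHessianSosPlusTwo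
import Summits.ValiantsHypothesis.ValiantsHypothesis.Theorems.RefutationDegreeBeyondHessianNsStubMrPointSmooth
import Summits.ValiantsHypothesis.ValiantsHypothesis.Theorems.RefutationDegreeBeyondHessianNsStubZariskiDense
import Summits.ValiantsHypothesis.ValiantsHypothesis.Theorems.RefutationDegreeBeyondHessianNsStubFanoClosed
import Summits.ValiantsHypothesis.ValiantsHypothesis.Theorems.RefutationDegreeBeyondHessianNsStubKernelPlaneEval
import Summits.ValiantsHypothesis.ValiantsHypothesis.Theorems.RefutationDegreeBeyondHessianNsStubNoBigFlat
import Summits.ValiantsHypothesis.ValiantsHypothesis.Theorems.RefutationDegreeBeyondHessianNsJetSeparation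

/-!
# Line `Sketch` — skeleton v11r for crux `RefutationDegree.BeyondHessianNs` (stmt-ValiantsHypothesis-5641)

Crux (by name): `Summit.ValiantsHypothesis.ValiantsHypothesis.Theses.RefutationDegree.BeyondHessianNs` =
`∃ c n₀, ∀ n ≥ n₀`, the coefficient system `Rep(n, m)` of the defect `P = det A(x) - per_n(x)` of the
generic affine pencil of size `m = ⌊n²/2⌋ + 1` has a Nullstellensatz refutation `Σ_μ h_μ · coeff_μ P = 1`
with all products of degree `≤ n ^ c`.

## Composition v10 (lead continuation c2, 2026-08-17): the EXISTENCE half becomes provable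

`BeyondHessianNs_of` := `polyJetEq` → `calibration_translated` (LANDED, p118805) → degree arithmetic, and
`polyJetEq` := [`jetSeparationMr` (E at the Mignon–Ressayre point, now DERIVED) + `stub_mrPointSmooth` (S1) +
`stub_polyDegreeSeparation` (D, OPEN: the crux's certificate-degree content at `y₀`)].

E is DERIVED from four provable stubs (new in v10), because two inputs are now in the tree:
(i) the sibling crux `BeyondHessianSos` landed `…BeyondHessianSosPlusTwo.nine_mul_finrank_flat_le`: every LINEAR
subspace `W ∋ y₀` of matrix space with `per_n|_W ≡ 0` has `9 dim W + 9 ≤ 4(n-1)² + 36(n-1)` (no Hessian, no parity);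
(ii) `Literature…OrbitClosureEuclidean.mem_closure_range_of_ker_bind₁_le`: a common zero of the polynomials vanishing on
the image of a complex polynomial map lies in the CLASSICAL closure of the image (Chevalley + density theorem).
Hence: if the jet of `per_n(X + y₀)` were in the Zariski closure of the jet variety
`𝒮_n = {coeff det(Λ₀ + Σ_e X_e Z_e)}` (`m = ⌊n²/2⌋ + 1`), then (S2 `stub_zariskiDense`) its restriction to the
exponents of degree `≤ m` is a classical limit of restricted jets of `𝒮_n`; every jet of `𝒮_n` vanishes on its kernel
plane `{v : Z(v) e₀ = 0}` of dimension `≥ n² - m` (S4 `stub_kernelPlaneEval`); the locus of coefficient vectors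
vanishing on SOME `k`-plane is classically closed (S3 `stub_fanoClosed`: orthonormal frames form a compact set, evaluation
is jointly continuous); so `per_n(y₀ + v) = 0` on a linear `V` of dimension `≥ n² - m = ⌈n²/2⌉ - 1`, and
`W = ℂ y₀ + V` contradicts (i) for `n ≥ 55` (S5 `stub_noBigFlat`: `9 ⌈n²/2⌉ > 4 n² + 28 n - 32`).

* S1 `stub_mrPointSmooth` — `y₀` is a smooth point of `{per_n = 0}` (Euler; the proof of `stub_mrJetInstance` has it).
* S2 `stub_zariskiDense` — Zariski closure ⊂ classical closure for `𝒮_n`, restricted to any finite set of exponents.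
* S3 `stub_fanoClosed` — abstract: limits of coefficient vectors each vanishing on a `k`-plane vanish on a `k`-plane.
* S4 `stub_kernelPlaneEval` — the kernel plane of `det(Λ₀ + Σ X_e Z_e)`, in evaluated (`Σ_μ c_μ v^μ`) form.
* S5 `stub_noBigFlat` — no linear `V` with `dim V ≥ ⌈n²/2⌉ - 1` and `y₀ + V ⊂ Z(per_n)`, `n ≥ 55` (from (i)).
* D `stub_polyDegreeSeparation` (OPEN) — at `y₀`, for all large `n`: IF the jet of `per_n(X + y₀)` is outside the Zariski
  closure of `𝒮_n` (a THEOREM once S1–S5 land) THEN some polynomial of degree `≤ n^c` vanishing on `𝒮_n` does not vanish at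
  it.  This is the Nullstellensatz-DEGREE content of the crux in pure form (v9's `stub_idealDegree` asked it uniformly for
  every point outside the closure — needlessly strong; v10 asks it only at the jet the composition uses).  Its failure for
  all `c` is the `Ψ`-shadow of crux #3 `RefutationBarrier`.

## History
v1–v5 (lead -0): infeasibility at odd `n` (`stub_oddInfeasible`, p111216) + Fano transfer + point lemma + bridges.
v6–v9 (c1): JET CALIBRATION p116196, plumbing W1–W4, jet form p118805, MR end-to-end p130373; v9 split the open content
into E `stub_jetSeparation` (existence) and D `stub_idealDegree` (degree, uniform).
v10 (c2): E derived from S1–S5 (all provable now); D sharpened to the point form at `y₀`.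
v10r (c2, wave 1): S1–S5 ALL LANDED (p137047, p137255, p137248, p137201, p137265): E is a THEOREM; the only `sorry` left is D.
v11 (c2): E registered as `stub_jetSeparationMr` (to land the composition as a Theorems file); `jetSeparationMr_of_stubs` keeps the derivation.
v11r (c2): `stub_jetSeparationMr` LANDED p137607 (`…JetSeparation.lean`, with `jetSeparation` = v9's E). EXACTLY ONE `sorry` left: D `stub_polyDegreeSeparation`.

## Disproof.lean used
None exists for this crux (`ledger crux ls`: no `Disproof.lean`; payload `disproof_path` not mounted), 2026-08-17T01:40Z.
-/

noncomputable section

-- `Summit.ValiantsHypothesis.ValiantsHypothesis.…` is the tree's mandated single-conjunct layout.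
set_option linter.dupNamespace false

namespace Summit.ValiantsHypothesis.ValiantsHypothesis.Cruxes.BeyondHessianNs.Sketch

open MvPolynomial Matrix
open Literature.Computability.AlgebraicComplexity

/-! ## Local notation -/

/-- The determinant of the pencil `Λ₀ + Σ_e X_e Z_e` with constant part `Λ₀ = diag(0,1,…,1)` of size `⌊n²/2⌋ + 1`
(local notation). -/
local notation3 (prettyPrint := false) "pencilDet[" n ", " Z "]" =>
  (((Literature.Computability.AlgebraicComplexity.lamMatrix ℂ (0 : Fin (n ^ 2 / 2 + 1))).map MvPolynomial.C +
      ∑ e : Fin n × Fin n, (MvPolynomial.X e : MvPolynomial (Fin n × Fin n) ℂ) •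
        (Z e).map (MvPolynomial.C : ℂ →+* MvPolynomial (Fin n × Fin n) ℂ) :
      Matrix (Fin (n ^ 2 / 2 + 1)) (Fin (n ^ 2 / 2 + 1)) (MvPolynomial (Fin n × Fin n) ℂ)).det)

/-- The jet variety of the line at size `m = ⌊n²/2⌋ + 1`: coefficient vectors of `det(Λ₀ + Σ_e x_e Z_e)`, `Z ∈ (ℂ^{m×m})^{n×n}`
(local notation, byte-identical with v9). -/
local notation3 (prettyPrint := false) "jetVariety[" n "]" =>
  Set.range (fun Z : Fin n × Fin n → Matrix (Fin (n ^ 2 / 2 + 1)) (Fin (n ^ 2 / 2 + 1)) ℂ =>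
    fun μ : Fin n × Fin n →₀ ℕ => MvPolynomial.coeff μ
      (((Literature.Computability.AlgebraicComplexity.lamMatrix ℂ (0 : Fin (n ^ 2 / 2 + 1))).map MvPolynomial.C +
        ∑ e : Fin n × Fin n, (MvPolynomial.X e : MvPolynomial (Fin n × Fin n) ℂ) •
          (Z e).map (MvPolynomial.C : ℂ →+* MvPolynomial (Fin n × Fin n) ℂ) :
          Matrix (Fin (n ^ 2 / 2 + 1)) (Fin (n ^ 2 / 2 + 1)) (MvPolynomial (Fin n × Fin n) ℂ)).det))

/-- The finite set of exponents of degree `≤ ⌊n²/2⌋ + 1` on the `n × n` variables (local notation). -/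
local notation3 (prettyPrint := false) "degLE[" n "]" =>
  ((Finset.range (n ^ 2 / 2 + 1 + 1)).biUnion
    (fun k => (Finset.univ : Finset (Fin n × Fin n)).finsuppAntidiag k))

/-! ## Registered stubs (v10) -/

/-- **S1 — the Mignon–Ressayre point is a smooth point of the permanental hypersurface** (LANDED p137047, `…StubMrPointSmooth.lean`): some first partial of
`per_{p+3}` does not vanish at `y₀ = J - (p+3) E₀₀` (Euler's identity and the injectivity of the Hessian pattern, exactly as
in the proof of `…StubMrJetInstance.stub_mrJetInstance`; or directly `∂_{00} per (y₀) = per(J_{p+2}) = (p+2)!`). -/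
theorem stub_mrPointSmooth : ∀ p : ℕ, ∃ e : Fin (p + 3) × Fin (p + 3),
    MvPolynomial.eval (Literature.Computability.AlgebraicComplexity.mrPoint ℂ p)
      (MvPolynomial.pderiv e (Literature.Computability.AlgebraicComplexity.perPoly (Fin (p + 3)) ℂ)) ≠ 0 :=
  Summit.ValiantsHypothesis.ValiantsHypothesis.Theorems.RefutationDegreeBeyondHessianNs.stub_mrPointSmooth

/-- **S2 — Zariski closure ⊂ classical closure for the jet variety** (LANDED p137255, `…StubZariskiDense.lean`) (on any finite set `F` of exponents): if `p` is a
common zero of all polynomials (in the coefficient coordinates) vanishing on the jet variety, then the restriction of `p`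
to `F` is a limit, for the classical topology of `F → ℂ`, of restrictions of jets `coeff det(Λ₀ + Σ_e X_e Z_e)`.
(The jet map is polynomial in the entries of `Z`: apply
`Literature.Computability.AlgebraicComplexity.mem_closure_range_of_ker_bind₁_le` to
`P_μ = coeff_μ det(Λ₀ + Σ_e X_e Z_e^{gen})` over the finite variable type `(Fin n × Fin n) × Fin m × Fin m`, `μ ∈ F`;
a polynomial identity `Ψ(P) = 0` gives `rename (↑) Ψ ∈ vanishingIdeal (jet variety)`, hence `Ψ(p|_F) = 0`.) -/
theorem stub_zariskiDense : ∀ (n : ℕ) (F : Finset (Fin n × Fin n →₀ ℕ)) (p : (Fin n × Fin n →₀ ℕ) → ℂ),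
    p ∈ MvPolynomial.zeroLocus ℂ (MvPolynomial.vanishingIdeal ℂ (jetVariety[n])) →
    (fun μ : ↥F => p μ.1) ∈ closure (Set.range fun Z : Fin n × Fin n →
        Matrix (Fin (n ^ 2 / 2 + 1)) (Fin (n ^ 2 / 2 + 1)) ℂ =>
          fun μ : ↥F => MvPolynomial.coeff μ.1 (pencilDet[n, Z])) :=
  Summit.ValiantsHypothesis.ValiantsHypothesis.Theorems.RefutationDegreeBeyondHessianNs.stub_zariskiDense

/-- **S3 — the Fano locus is classically closed** (LANDED p137248, `…StubFanoClosed.lean`) (abstract): let `F` be a finite set of exponents on a finite variable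
type `σ`, `k : ℕ`, and `S` a set of coefficient vectors `c : F → ℂ` each of whose polynomials `Σ_{μ ∈ F} c_μ x^μ` vanishes
identically on some linear subspace of dimension `≥ k`; then the same holds for every `c₀` in the classical closure of `S`.
(Shrink to dimension exactly `k`, take orthonormal frames `b ∈ (EuclideanSpace ℂ σ)^k` — a compact set — extract a convergent
subsequence (`IsCompact.tendsto_subseq`), and pass to the limit in `Σ_μ c_μ (Σ_i t_i b_i)^μ = 0`, which is jointly continuous
in `(c, b)`; an orthonormal limit frame spans a `k`-dimensional subspace.) -/
theorem stub_fanoClosed : ∀ {σ : Type} [Fintype σ] [DecidableEq σ] (F : Finset (σ →₀ ℕ)) (k : ℕ)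
    (S : Set (↥F → ℂ)),
    (∀ c ∈ S, ∃ V : Submodule ℂ (σ → ℂ), k ≤ Module.finrank ℂ V ∧
      ∀ v ∈ V, ∑ μ : ↥F, c μ * ∏ i, v i ^ (μ.1 i) = 0) →
    ∀ c₀ : ↥F → ℂ, c₀ ∈ closure S →
      ∃ V : Submodule ℂ (σ → ℂ), k ≤ Module.finrank ℂ V ∧
        ∀ v ∈ V, ∑ μ : ↥F, c₀ μ * ∏ i, v i ^ (μ.1 i) = 0 :=
  Summit.ValiantsHypothesis.ValiantsHypothesis.Theorems.RefutationDegreeBeyondHessianNs.stub_fanoClosed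

/-- **S4 — the kernel plane of a `Λ₀`-pencil, evaluated form** (LANDED p137201, `…StubKernelPlaneEval.lean`): for constant matrices `Z_e` of size `m = ⌊n²/2⌋ + 1`, the
polynomial `g = det(Λ₀ + Σ_e X_e Z_e)` vanishes identically on the linear subspace `V = {v : Σ_e v_e (Z_e)_{i0} = 0 ∀ i}`
(the first column of `Λ₀ + Z(v)` vanishes), `dim V ≥ n² - m` (rank–nullity), and `g(v) = Σ_{|μ| ≤ m} coeff_μ g · v^μ`
(`deg g ≤ m`: `totalDegree_det_le_of_affine`, `totalDegree_lamPencil_le`; `MvPolynomial.eval_eq'`). -/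
theorem stub_kernelPlaneEval : ∀ (n : ℕ)
    (Z : Fin n × Fin n → Matrix (Fin (n ^ 2 / 2 + 1)) (Fin (n ^ 2 / 2 + 1)) ℂ),
    ∃ V : Submodule ℂ (Fin n × Fin n → ℂ), n ^ 2 ≤ Module.finrank ℂ V + (n ^ 2 / 2 + 1) ∧
      ∀ v ∈ V, ∑ μ : ↥(degLE[n]), MvPolynomial.coeff μ.1 (pencilDet[n, Z]) * ∏ i, v i ^ (μ.1 i) = 0 :=
  Summit.ValiantsHypothesis.ValiantsHypothesis.Theorems.RefutationDegreeBeyondHessianNs.stub_kernelPlaneEval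

/-- **S5 — no big flat of the permanental hypersurface through the Mignon–Ressayre point** (LANDED p137265, `…StubNoBigFlat.lean`) (`n = p + 3 ≥ 55`): there is
no linear `V` with `dim V ≥ n² - (⌊n²/2⌋ + 1)` such that `per_n(y₀ + v) = 0` for all `v ∈ V` — here written with
`per_n(y₀ + v) = Σ_{|μ| ≤ m} coeff_μ (per_n(X + y₀)) v^μ` (`eval_transl`, `deg per_n(X + y₀) ≤ n ≤ m`).  Proof: `W = ℂ y₀ + V`
is a linear space containing `y₀` on which `per_n` vanishes (homogeneity `per(s y₀ + v) = sⁿ per(y₀ + v/s)` for `s ≠ 0`,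
and `…StubEvenTransfer.eval_eq_zero_of_forall_ne_zero` for `s = 0`), so
`…BeyondHessianSosPlusTwo.nine_mul_finrank_flat_le` gives `9 dim V + 9 ≤ 4(n-1)² + 36(n-1)`, contradicting
`dim V ≥ ⌈n²/2⌉ - 1` for `n ≥ 55`. -/
theorem stub_noBigFlat : ∀ (p : ℕ), 52 ≤ p →
    ∀ V : Submodule ℂ (Fin (p + 3) × Fin (p + 3) → ℂ),
      (p + 3) ^ 2 ≤ Module.finrank ℂ V + ((p + 3) ^ 2 / 2 + 1) →
      (∀ v ∈ V, ∑ μ : ↥(degLE[p + 3]), MvPolynomial.coeff μ.1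
          (Literature.Computability.AlgebraicComplexity.transl
            (Literature.Computability.AlgebraicComplexity.mrPoint ℂ p)
            (Literature.Computability.AlgebraicComplexity.perPoly (Fin (p + 3)) ℂ)) * ∏ i, v i ^ (μ.1 i) = 0) →
      False :=
  Summit.ValiantsHypothesis.ValiantsHypothesis.Theorems.RefutationDegreeBeyondHessianNs.stub_noBigFlat

/-- **D — POLYNOMIAL-DEGREE SEPARATION AT THE MIGNON–RESSAYRE POINT** (OPEN; the crux's certificate content in pure
form): for all large `n = p + 3`, IF the jet of `per_n(X + y₀)` lies outside the Zariski closure of the jet variety at size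
`⌊n²/2⌋ + 1` (a theorem once S1–S5 land: `jetSeparationMr`), THEN it is missed by a polynomial of degree `≤ n ^ c` vanishing
on the jet variety.  (Mignon–Ressayre's `(2m+1)`-minors of the Hessian functional do this one size lower, in degree
`2m + 1`; at this size no determinantal equation is visible numerically — kit j019401 — and the equations are
Fano / bi-Lagrangian eliminants of unknown degree.  Its failure for every `c` is the `Ψ`-shadow of crux #3 `RefutationBarrier`.) -/
theorem stub_polyDegreeSeparation : ∃ c n₀ : ℕ, ∀ p ≥ n₀,
    (fun μ : Fin (p + 3) × Fin (p + 3) →₀ ℕ => MvPolynomial.coeff μ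
        (Literature.Computability.AlgebraicComplexity.transl
          (Literature.Computability.AlgebraicComplexity.mrPoint ℂ p)
          (Literature.Computability.AlgebraicComplexity.perPoly (Fin (p + 3)) ℂ))) ∉
      MvPolynomial.zeroLocus ℂ (MvPolynomial.vanishingIdeal ℂ (jetVariety[p + 3])) →
    ∃ Ψ ∈ MvPolynomial.vanishingIdeal ℂ (jetVariety[p + 3]),
      Ψ.totalDegree ≤ (p + 3) ^ c ∧
      MvPolynomial.eval (fun μ : Fin (p + 3) × Fin (p + 3) →₀ ℕ => MvPolynomial.coeff μ
        (Literature.Computability.AlgebraicComplexity.transl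
          (Literature.Computability.AlgebraicComplexity.mrPoint ℂ p)
          (Literature.Computability.AlgebraicComplexity.perPoly (Fin (p + 3)) ℂ))) Ψ ≠ 0 := by
  sorry

/-! ## Derived: E — jet separation (the existence half), from S2–S5 -/

/-- **E at the Mignon–Ressayre point** (registered stub of v11; LANDED p137607, PROVED from S2–S5 in
`Theorems/RefutationDegreeBeyondHessianNsJetSeparation.lean`, composition shown in the v10 history of this file): for
`n = p + 3 ≥ 55`, the jet of `per_n(X + y₀)` lies OUTSIDE the Zariski closure of the jet variety
`{coeff det(Λ₀ + Σ_e X_e Z_e)}` at size `⌊n²/2⌋ + 1`.  Proof: `stub_zariskiDense` puts the degree-`≤ m` restriction of the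
jet in the classical closure of restricted jets; `stub_kernelPlaneEval` + `stub_fanoClosed` produce a linear `V`,
`dim V ≥ n² − m`, with `per_n(y₀ + v) = 0` on `V`; `stub_noBigFlat` (sibling flat bound) is the contradiction. -/
theorem stub_jetSeparationMr : ∀ (p : ℕ), 52 ≤ p →
    (fun μ : Fin (p + 3) × Fin (p + 3) →₀ ℕ => MvPolynomial.coeff μ
        (Literature.Computability.AlgebraicComplexity.transl
          (Literature.Computability.AlgebraicComplexity.mrPoint ℂ p)
          (Literature.Computability.AlgebraicComplexity.perPoly (Fin (p + 3)) ℂ))) ∉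
      MvPolynomial.zeroLocus ℂ (MvPolynomial.vanishingIdeal ℂ (jetVariety[p + 3])) :=
  Summit.ValiantsHypothesis.ValiantsHypothesis.Theorems.RefutationDegreeBeyondHessianNs.stub_jetSeparationMr

/-- The v10 derivation of `stub_jetSeparationMr` from S2–S5, kept in the skeleton as a cross-check of the composition
(identical to the landed proof). -/
theorem jetSeparationMr_of_stubs (p : ℕ) (hp : 52 ≤ p) :
    (fun μ : Fin (p + 3) × Fin (p + 3) →₀ ℕ => MvPolynomial.coeff μ
        (transl (mrPoint ℂ p) (perPoly (Fin (p + 3)) ℂ))) ∉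
      MvPolynomial.zeroLocus ℂ (MvPolynomial.vanishingIdeal ℂ (jetVariety[p + 3])) := by
  intro hmem
  -- Zariski closure ⊂ classical closure, on the exponents of degree `≤ m`
  have hcl := stub_zariskiDense (p + 3) (degLE[p + 3]) _ hmem
  -- every jet of the jet variety vanishes on a plane of dimension `≥ n² - m`; pass to the limit
  obtain ⟨V, hkV, hV⟩ := stub_fanoClosed (degLE[p + 3]) ((p + 3) ^ 2 - ((p + 3) ^ 2 / 2 + 1)) _
    (by
      rintro c ⟨Z, rfl⟩
      obtain ⟨V, hV1, hV2⟩ := stub_kernelPlaneEval (p + 3) Z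
      exact ⟨V, Nat.sub_le_iff_le_add.mpr hV1, hV2⟩) _ hcl
  -- a flat of dimension `≥ ⌈n²/2⌉ - 1` through `y₀`: impossible for `n ≥ 55`
  exact stub_noBigFlat p hp V (Nat.sub_le_iff_le_add.mp hkV) hV

/-- **E — JET SEPARATION** (the registered stub `stub_jetSeparation` of v9, now DERIVED): for all large `n` there is a smooth
zero `y` of `per_n` such that the coefficient vector of `per_n(X + y)` lies OUTSIDE the Zariski closure of the jet variety at
size `⌊n²/2⌋ + 1`. -/
theorem jetSeparation : ∃ n₀ : ℕ, ∀ n ≥ n₀,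
    ∃ (y : Fin n × Fin n → ℂ) (e : Fin n × Fin n),
      MvPolynomial.eval y (Literature.Computability.AlgebraicComplexity.perPoly (Fin n) ℂ) = 0 ∧
      MvPolynomial.eval y (MvPolynomial.pderiv e
        (Literature.Computability.AlgebraicComplexity.perPoly (Fin n) ℂ)) ≠ 0 ∧
      (fun μ : Fin n × Fin n →₀ ℕ => MvPolynomial.coeff μ
        (Literature.Computability.AlgebraicComplexity.transl y
          (Literature.Computability.AlgebraicComplexity.perPoly (Fin n) ℂ))) ∉
        MvPolynomial.zeroLocus ℂ (MvPolynomial.vanishingIdeal ℂ (jetVariety[n])) := by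
  refine ⟨55, fun n hn => ?_⟩
  obtain ⟨p, rfl⟩ : ∃ p, n = p + 3 := ⟨n - 3, by omega⟩
  obtain ⟨e, he⟩ := stub_mrPointSmooth p
  exact ⟨mrPoint ℂ p, e, eval_mrPoint_perPoly, he, stub_jetSeparationMr p (by omega)⟩

/-- **POLY JET EQUATION, jet form** — DERIVED from E (`jetSeparationMr`, S1) and D (`stub_polyDegreeSeparation`): for all
large `n` there are a smooth zero `y` of `per_n` and a polynomial `Ψ̃` of degree `≤ n ^ c` in jet coordinates with
`Ψ̃(per_n(x + y)) ≠ 0` satisfying the polynomial identity `Ψ̃(coeff det(Λ₀ + Σ_e x_e Z_e)) = 0` for all complex `Z`,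
`m = ⌊n²/2⌋ + 1`. -/
theorem polyJetEq : ∃ c n₀ : ℕ, ∀ n ≥ n₀,
    ∃ (y : Fin n × Fin n → ℂ) (e : Fin n × Fin n) (Ψ : MvPolynomial (Fin n × Fin n →₀ ℕ) ℂ),
      MvPolynomial.eval y (Literature.Computability.AlgebraicComplexity.perPoly (Fin n) ℂ) = 0 ∧
      MvPolynomial.eval y (MvPolynomial.pderiv e
        (Literature.Computability.AlgebraicComplexity.perPoly (Fin n) ℂ)) ≠ 0 ∧
      Ψ.totalDegree ≤ n ^ c ∧
      MvPolynomial.eval (fun μ => MvPolynomial.coeff μ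
        (Literature.Computability.AlgebraicComplexity.transl y
          (Literature.Computability.AlgebraicComplexity.perPoly (Fin n) ℂ))) Ψ ≠ 0 ∧
      ∀ Z : Fin n × Fin n → Matrix (Fin (n ^ 2 / 2 + 1)) (Fin (n ^ 2 / 2 + 1)) ℂ,
        MvPolynomial.eval (fun μ => MvPolynomial.coeff μ (pencilDet[n, Z])) Ψ = 0 := by
  obtain ⟨c, n₁, hD⟩ := stub_polyDegreeSeparation
  refine ⟨c, max (n₁ + 3) 55, fun n hn => ?_⟩
  obtain ⟨p, rfl⟩ : ∃ p, n = p + 3 := ⟨n - 3, by omega⟩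
  obtain ⟨e, he⟩ := stub_mrPointSmooth p
  have hout := stub_jetSeparationMr p (by omega)
  obtain ⟨Ψ, hΨmem, hΨD, hΨp⟩ := hD p (by omega) hout
  refine ⟨mrPoint ℂ p, e, Ψ, eval_mrPoint_perPoly, he, hΨD, hΨp, fun Z => ?_⟩
  rw [MvPolynomial.mem_vanishingIdeal_iff] at hΨmem
  exact hΨmem _ ⟨Z, rfl⟩

/-! ## Proved glue: calibration in jet form -/

/-- The defect `P = det A(x) - per_n(x) ∈ R[x]` of the system `Rep(n,m)` (local notation; the crux
inlines it). -/
local notation3 (prettyPrint := false) "defect[" n ", " m "]" =>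
  ((Matrix.of fun i j : Fin m =>
      MvPolynomial.C (MvPolynomial.X (none, (i, j))) +
        ∑ e : Fin n × Fin n, MvPolynomial.X e * MvPolynomial.C (MvPolynomial.X (some e, (i, j))) :
    Matrix (Fin m) (Fin m) (MvPolynomial (Fin n × Fin n)
      (MvPolynomial (Option (Fin n × Fin n) × (Fin m × Fin m)) ℂ))).det -
    MvPolynomial.map MvPolynomial.C (Literature.Computability.AlgebraicComplexity.perPoly (Fin n) ℂ))

/-- **CALIBRATION IN JET FORM** (LANDED: `…JetCalibrationTranslated.exists_refutation_of_jet_identity`, p118805).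
`m ≥ 1`, `y` a zero of `per_n` with `∂_e per_n(y) ≠ 0`, `Ψ̃` of degree `≤ D` with `Ψ̃(coeff per_n(X + y)) ≠ 0` and
`Ψ̃(coeff det(Λ_{i₀} + Σ_e X_e Z_e)) = 0` for all complex `Z`.  Then `Rep(n,m)` has a Nullstellensatz refutation with
products of degree `≤ m (D + 1)`. -/
theorem calibration_translated {n m : ℕ} (hm : 0 < m) (i₀ : Fin m) (y : Fin n × Fin n → ℂ)
    (hy : eval y (perPoly (Fin n) ℂ) = 0) (e : Fin n × Fin n)
    (he : eval y (pderiv e (perPoly (Fin n) ℂ)) ≠ 0) {D : ℕ}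
    (Ψ : MvPolynomial (Fin n × Fin n →₀ ℕ) ℂ) (hΨD : Ψ.totalDegree ≤ D)
    (hΨper : eval (fun μ => coeff μ (transl y (perPoly (Fin n) ℂ))) Ψ ≠ 0)
    (hΨvan : ∀ Z : Fin n × Fin n → Matrix (Fin m) (Fin m) ℂ,
      eval (fun μ => coeff μ (((lamMatrix ℂ i₀).map C +
        ∑ e : Fin n × Fin n, (X e : MvPolynomial (Fin n × Fin n) ℂ) •
          (Z e).map (C : ℂ →+* MvPolynomial (Fin n × Fin n) ℂ) :
        Matrix (Fin m) (Fin m) (MvPolynomial (Fin n × Fin n) ℂ)).det)) Ψ = 0) :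
    ∃ hh : (Fin n × Fin n →₀ ℕ) → MvPolynomial (Option (Fin n × Fin n) × (Fin m × Fin m)) ℂ,
      (∀ μ, (hh μ * (defect[n, m]).coeff μ).totalDegree ≤ m * (D + 1)) ∧
        ∑ μ ∈ (defect[n, m]).support, hh μ * (defect[n, m]).coeff μ = 1 :=
  Summit.ValiantsHypothesis.ValiantsHypothesis.Theorems.RefutationDegreeBeyondHessianNs.exists_refutation_of_jet_identity
    hm i₀ y hy e he Ψ hΨD hΨper hΨvan

/-! ## Composition: the line concludes the crux BY NAME (modulo the stubs) -/

/-- **The line concludes the crux** `RefutationDegree.BeyondHessianNs`: jet-form separating polynomials of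
degree `n^c` (`polyJetEq` ⇐ E + D) are Nullstellensatz refutations of degree `(⌊n²/2⌋+1) · (n^c + 1) ≤ n^{c+3}`
(`calibration_translated`). -/
theorem BeyondHessianNs_of :
    Summit.ValiantsHypothesis.ValiantsHypothesis.Theses.RefutationDegree.BeyondHessianNs := by
  have key : Summit.ValiantsHypothesis.ValiantsHypothesis.Theses.RefutationDegree.BeyondHessianNs ↔
      ∃ c n₀ : ℕ, ∀ n ≥ n₀,
        ∃ hh : (Fin n × Fin n →₀ ℕ) →
            MvPolynomial (Option (Fin n × Fin n) × (Fin (n ^ 2 / 2 + 1) × Fin (n ^ 2 / 2 + 1))) ℂ,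
          (∀ μ, (hh μ * (defect[n, n ^ 2 / 2 + 1]).coeff μ).totalDegree ≤ n ^ c) ∧
            ∑ μ ∈ (defect[n, n ^ 2 / 2 + 1]).support, hh μ * (defect[n, n ^ 2 / 2 + 1]).coeff μ = 1 :=
    Iff.rfl
  obtain ⟨c, n₀, hc⟩ := polyJetEq
  refine key.mpr ⟨c + 3, max n₀ 2, fun n hn => ?_⟩
  obtain ⟨y, e, Ψ, hy, he, hΨD, hΨper, hΨvan⟩ := hc n (le_of_max_le_left hn)
  obtain ⟨hh, hdeg, hsum⟩ := calibration_translated (n := n) (m := n ^ 2 / 2 + 1) (Nat.succ_pos _)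
    0 y hy e he Ψ hΨD hΨper hΨvan
  refine ⟨hh, fun μ => (hdeg μ).trans ?_, hsum⟩
  have h2 : 2 ≤ n := le_of_max_le_right hn
  have hsq : n ^ 2 / 2 + 1 ≤ n ^ 2 := by
    have : 2 * 2 ≤ n ^ 2 := by rw [sq]; exact Nat.mul_le_mul h2 h2
    omega
  have hc1 : n ^ c + 1 ≤ n ^ (c + 1) := by
    have h1 : 1 ≤ n ^ c := Nat.one_le_pow _ _ (by omega)
    calc n ^ c + 1 ≤ n ^ c + n ^ c := Nat.add_le_add_left h1 _
      _ = n ^ c * 2 := by ring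
      _ ≤ n ^ c * n := Nat.mul_le_mul_left _ h2
      _ = n ^ (c + 1) := by ring
  calc (n ^ 2 / 2 + 1) * (n ^ c + 1) ≤ n ^ 2 * n ^ (c + 1) := Nat.mul_le_mul hsq hc1
    _ = n ^ (c + 3) := by ring

end Summit.ValiantsHypothesis.ValiantsHypothesis.Cruxes.BeyondHessianNs.Sketch

end
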